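/-
Copyright (c) 2026 the pub-hodgecm-mathlib formalisation cell (harness21).  Prover seat hodgecm-mathlib-R90-C10-p01 (g3), SLAB R90-TF, section S1 «Ch. 10∕12 local»;
crux H413 = `stmt-HodgeConjecture-24833`; line «B_pos-inert» (U4Keys :182, Branch B at positive depth, lead R90-C10-p05 (g2)) — DYADIC∕ALL-INERT corner, brick (B-9c)
of the census `R90/R90-C10-p01/g3/CENSUS-Bpos-dyadic.md` f5a80797891aac96, dealt BY NAME by R90-C10-plan (g2) in ruling R-S1-17 (2026-09-05T00:07:33Z).
KERNEL module: THEOREMS ONLY (no definition, no named fact, no `sorry`, no instance, no notation).  2026-09-05.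
-/
import Summits.HodgeConjecture.HodgeConjecture.Theorems.R90S1BposDyadicTraceCutOrthogonality   -- ★ (B-9c) FILE B (this seat): `integral_indicator_shearLineIntegral_eq_zero_of_traceCut`, `integral_indicator_sphere_shearLineIntegral_eq`; brings ★ FILE A (`shearLineIntegral_eq_of_valued_eq`, (K-hi-c), `valued_eq_pow_iff`, `measureReal_fixedBall_pow_succ`), ★ PART 3∕1, ★ shear kit, ★ L-β0
import HarnessLib

/-!
# R90-TF · S1 «Ch10-local» ∕ K2 E3 «U4Keys» :182, BRANCH B AT POSITIVE DEPTH — brick (B-9c) FILE C `R90S1BposDyadicSkewLineFibreValues`: (K-lo-c) `K_c(t) = 0` FOR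
# `|ϖ|^m < |t|_w` AND (K-mid-c) `K_c(t) = −ε₀·m₀` FOR `|t|_w = |ϖ|^m` — THE SKEW-LINE FIBRES AT A SHEARED BASE POINT, EVERY INERT PLACE, ANY RESIDUE CHARACTERISTIC
# [Keys1984 §4–§5, §7 Thm (2); Roche1998 §3–§4; WeilBNT1967 Ch. II §5; Serre1979 Ch. V §2; Rogawski1990 §1.10, §12.2]

Cell `pub/hodgecm-mathlib`, crux H413 = `stmt-HodgeConjecture-24833`, route of record `HCCMUnconditional` (no route verbs); R90-TF section S1 (base R90-C10), dealer
R90-C10-plan (g2) (R-S1-17), line lead R90-C10-p05 (g2), auditor R90-C10-audit1 (g2).  THEOREMS ONLY; lane `--supports stmt-HodgeConjecture-24833 --as helper`, count-neutral.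
NOT THE PAYER of :182.  Third of three files of brick (B-9c) (A = ★ `R90S1BposDyadicSkewLineFibresSheared`, B = ★ `R90S1BposDyadicTraceCutOrthogonality`).

THE POINT (census `CENSUS-Bpos-dyadic.md` f5a80797891aac96 §2–§3; audit box 00:08:30Z; method pre-read 00:14:03Z).  R90-C10-p04 (g2)'s fibre letters (K-hi)(K-mid)(K-lo) at a
σ-FIXED base `a` bind `h2w : |2|_w = 1`, and (K-mid)∕(K-lo) are FALSE at an inert dyadic place with `h2w` deleted (ℚ₂(√−3), conductor 2).  At the SHEARED base `t·c`
(`t` σ-fixed, `c` trace-one — K2E3-p32 (g2)'s d0B device) the SAME THREE VALUES hold with NO parity hypothesis; (K-hi-c) is ★ FILE A, and here: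
* **(K-lo-c)** `shearLineIntegral_eq_zero_of_pow_lt`: `|ϖ|^m < |t|_w ⟹ K_c(t) = 0` — for `|t| = |ϖ|^j`, `0 ≤ j < m` (`shearLineIntegral_eq_zero_of_valued_eq_pow_of_lt`): the sphere cut
  `{|x| = |ϖ|^j}` is `u₁`-stable, so `0 = ∫ 𝟙_{S_j} K_c dμ⁺ = μ⁺(S_j)·K_c(t)` (★ FILE B) with `μ⁺(S_j) > 0` (`μ⁺ :=` the Haar measure of `R⁺`); for `|t| > 1`: ★
  `shearLineIntegral_eq_zero_of_one_lt_valued` (empty region); the exponent `j` comes from discreteness (★ FILE A `exists_eq_pow_of_pow_lt_of_le_one`).  The case `j = 0` is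
  `Φ_c = 0`, ★ p863566 `R90S1BposDyadicUnitLevelShear` (R90-C10-p04 (g2)) by another road — not restated.
* **(K-mid-c)** `shearLineIntegral_eq_of_valued_eq_pow`: `|t|_w = |ϖ|^m ⟹ K_c(t) = −ε₀·m₀` (`ε₀ = χ₁(δ₀)`, `m₀ = μ⁻{|y|_w < 1}`): the ball cut `{|x| ≤ |ϖ|^m}` is `u₁`-stable, so
  `0 = ∫ 𝟙_{B_m} K_c = μ⁺(S_m)·K_c(t) + μ⁺(B_{m+1})·ε₀m₁` (★ FILE B; ★ FILE A sphere constancy and (K-hi-c)), and `μ⁺(S_m) = (q − 1)·μ⁺(B_{m+1})` (★ FILE A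
  `measureReal_fixedBall_pow_succ`), `m₁ = (q − 1)·m₀` (★ `measure_setOf_skew_valued_lt_one`) give the value.  At `v ∤ 2`, `c = ½`: p04's (K-mid) at `a := t∕2`.
LETTERS = p04's (K-·) prefix VERBATIM with `h2w` DELETED and `{a} (ha)` ↦ `{c} (hc) (hcw) {t} (ht)`, plus `hunr` ((K-mid-c) only: the ball ratios).
HONEST LABEL.  HC_CM is proved only modulo the 7 printed citations (2 remaining named inputs: hLiu418 = `stmt-HodgeConjecture-24832`, h413 = `stmt-HodgeConjecture-24833`) until
rung 0 closes; count-neutral — this file does NOT pay :182 or A2′; no printed citation is discharged; REL ≠ ★ ≠ BUILT.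

## References
* [Keys1984] D. Keys, *Principal series representations of special unitary groups over local fields*, Compositio Math. 51 (1984), §4–§5, §7 Theorem (2) p. 126.
* [Roche1998] A. Roche, *Types and Hecke algebras for principal series representations of split reductive p-adic groups*, Ann. Sci. ÉNS (4) 31 (1998), §3–§4.
* [WeilBNT1967] A. Weil, *Basic Number Theory* (1967), Ch. I §2–§4, Ch. II §5.
* [Serre1979] J.-P. Serre, *Local Fields*, GTM 67 (1979), Ch. II §1 (discrete valuations), Ch. V §2.
* [Rogawski1990] J. D. Rogawski, *Automorphic Representations of Unitary Groups in Three Variables*, Ann. of Math. Stud. 123 (1990), §1.10 p. 9, §12.2 (2) p. 173.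
-/

set_option autoImplicit false
-- the mandated namespace has the single-problem summit's repeated segment (`HodgeConjecture.HodgeConjecture`)
set_option linter.dupNamespace false

noncomputable section

open NumberField IsDedekindDomain MeasureTheory Measure Topology Set
open scoped NNReal ENNReal
open Literature.NumberTheory Literature.NumberTheory.Automorphic Literature.NumberTheory.Automorphic.UnitaryGroup

namespace Summit.HodgeConjecture.HodgeConjecture.R90.S1.BposDyadicSkewLineFibreValues

open Summit.HodgeConjecture.HodgeConjecture.Cruxes.H413
open Summit.HodgeConjecture.HodgeConjecture.Cruxes.H413.K2E3BranchBSkewUnitSign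
open Summit.HodgeConjecture.HodgeConjecture.Cruxes.H413.K2E3BranchBSkewLineIntegrals
open Summit.HodgeConjecture.HodgeConjecture.Cruxes.H413.K2E3BranchBSkewLineCharacterIntegral
open Summit.HodgeConjecture.HodgeConjecture.Cruxes.H413.K2E3BranchBShearLineIntegrals
open Summit.HodgeConjecture.HodgeConjecture.R90.S1.BposSkewBallCharacterTools
open Summit.HodgeConjecture.HodgeConjecture.R90.S1.BposSkewLineFibresDepth
open Summit.HodgeConjecture.HodgeConjecture.R90.S1.BposDyadicSkewLineFibresSheared
open Summit.HodgeConjecture.HodgeConjecture.R90.S1.BposDyadicTraceCutOrthogonality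

variable (L : Type) [Field L] [NumberField L] [IsCMField L] (v : HeightOneSpectrum (𝓞 ↥(maximalRealSubfield L)))
  (w : PlacesOver L v) (hw : IsCMField.complexConj L • w.1 = w.1)

section Fibres

variable [MeasurableSpace (LocalRing L v)] [BorelSpace (LocalRing L v)]
  (μY : Measure ↥(HeisRing.skewPart (conjLocal L (IsCMField.complexConj L) v))) [μY.IsAddHaarMeasure] [μY.Regular]

/-! ## §1 (K-lo-c) on the spheres inside the conductor, and assembled; §2 (K-mid-c) -/

open scoped Classical in
include hw in
/-- **(K-lo-c), SPHERES INSIDE THE CONDUCTOR — `|t|_w = |ϖ|^j`, `j < m` ⟹ `K_c(t) = 0`** (`j = 0`, i.e. `|t|_w = 1`, INCLUDED): the trace cut `P = {|x| = |ϖ|^j}` is stable under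
`|ϖ|^m`-perturbations (`j < m`), so `∫_{R⁺} 𝟙_{|t′| = |ϖ|^j} K_c = 0` (§3), `= μ⁺{|t′| = |ϖ|^j}·K_c(t)` (§4), and the sphere has positive finite mass (open, `∋ t`, inside the compact unit
ball) for `μ⁺ :=` the Haar measure of `R⁺`. [cite: Keys1984, §4–§5, §7 Theorem (2) p. 126] [cite: Roche1998, §3–§4] [cite: WeilBNT1967, Ch. II §5] -/
theorem shearLineIntegral_eq_zero_of_valued_eq_pow_of_lt (χ₁ : (LocalRing L v)ˣ →* ℂˣ) (h₁ : Continuous fun x => ((χ₁ x : ℂˣ) : ℂ))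
    (hfix : ∀ u : (LocalRing L v)ˣ, (∀ w' : PlacesOver L v, Valued.v ((u : LocalRing L v) w') = 1) →
      conjLocal L (IsCMField.complexConj L) v (u : LocalRing L v) = u → χ₁ u = 1)
    {ϖ : w.1.adicCompletion L} (hϖ : Valued.v ϖ = WithZero.exp (-1 : ℤ)) {m : ℕ} (hm : 1 ≤ m)
    (u₁ : (LocalRing L v)ˣ) (hu₁ : ∀ w' : PlacesOver L v, Valued.v (((u₁ : LocalRing L v) w') - 1) ≤ Valued.v ϖ ^ m) (hχu₁ : χ₁ u₁ ≠ 1)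
    {c : LocalRing L v} (hc : conjLocal L (IsCMField.complexConj L) v c + c = 1) (hcw : Valued.v (c w) ≤ 1)
    {t : LocalRing L v} (ht : conjLocal L (IsCMField.complexConj L) v t = t) {j : ℕ} (hjm : j < m) (htj : Valued.v (t w) = Valued.v ϖ ^ j) :
    ∫ y in {y : ↥(HeisRing.skewPart (conjLocal L (IsCMField.complexConj L) v)) | Valued.v ((t * c + (y : LocalRing L v)) w) = 1},
        (fun r : LocalRing L v => if h : IsUnit r then ((χ₁ h.unit : ℂˣ) : ℂ) else 0) (t * c + (y : LocalRing L v)) ∂μY = 0 := by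
  haveI : SecondCountableTopology (LocalRing L v) := secondCountableTopology_localRing (E := L) v
  have hσc := continuous_conjLocal L (IsCMField.complexConj L) v
  haveI := HeisRing.locallyCompactSpace_fixedPart (conjLocal L (IsCMField.complexConj L) v) hσc
  haveI : SecondCountableTopology ↥(HeisRing.fixedPart (conjLocal L (IsCMField.complexConj L) v)) := TopologicalSpace.Subtype.secondCountableTopology _
  set μP : Measure ↥(HeisRing.fixedPart (conjLocal L (IsCMField.complexConj L) v)) := Measure.addHaar with hμP
  have hϖ0 : 0 < Valued.v ϖ := by rw [hϖ]; exact WithZero.exp_pos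
  have hϖ1 : Valued.v ϖ < 1 := by rw [hϖ, ← WithZero.exp_zero]; exact WithZero.exp_lt_exp.2 (by norm_num)
  have hpj0 : Valued.v ϖ ^ j ≠ 0 := pow_ne_zero j hϖ0.ne'
  have ht0 : Valued.v (t w) ≠ 0 := by rw [htj]; exact hpj0
  -- the trace cut `P = {|x| = |ϖ|^j}`: Borel and stable under `|ϖ|^m`-perturbations (`j < m`)
  set P : Set (LocalRing L v) := {x : LocalRing L v | Valued.v (x w) = Valued.v ϖ ^ j} with hPdef
  have hP : MeasurableSet P := by
    have h : P = (fun x : LocalRing L v => x w) ⁻¹' {z : w.1.adicCompletion L | Valued.v z = Valued.v (ϖ ^ j)} := by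
      ext x; rw [hPdef, Set.mem_setOf_eq, Set.mem_preimage, Set.mem_setOf_eq, map_pow]
    rw [h]
    exact ((isOpen_setOf_valued_eq_valued L v w (by rw [map_pow]; exact hpj0)).preimage (continuous_apply w)).measurableSet
  have hPst : ∀ x x' : LocalRing L v, x ∈ P → Valued.v (x w) ≤ 1 → Valued.v ((x' - x) w) ≤ Valued.v ϖ ^ m → x' ∈ P := by
    intro x x' hx _ hxx'
    have hx' : Valued.v (x w) = Valued.v ϖ ^ j := hx
    have hlt : Valued.v ((x' - x) w) < Valued.v (x w) := by
      rw [hx']; exact lt_of_le_of_lt hxx' (pow_lt_pow_right_of_lt_one₀ hϖ0 hϖ1 hjm)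
    show Valued.v (x' w) = Valued.v ϖ ^ j
    rw [show x' w = x w + (x' - x) w by rw [Pi.sub_apply]; ring, Valuation.map_add_eq_of_lt_left _ hlt, hx']
  -- §3 + §4: `0 = μ⁺(sphere) · K_c(t)`
  have hzero := integral_indicator_shearLineIntegral_eq_zero_of_traceCut L v w hw μY χ₁ h₁ hϖ hm u₁ hu₁ hχu₁ hc hcw μP hP hPst
  have hsph : P = {x : LocalRing L v | Valued.v (x w) = Valued.v (t w)} := by rw [hPdef, htj]
  rw [hsph, integral_indicator_sphere_shearLineIntegral_eq L v w hw μY χ₁ hfix c μP ht ht0] at hzero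
  -- the sphere has positive finite mass
  set Sph : Set ↥(HeisRing.fixedPart (conjLocal L (IsCMField.complexConj L) v)) := {t' | Valued.v ((t' : LocalRing L v) w) = Valued.v (t w)} with hSph
  have hSo : IsOpen Sph := by
    have h : Sph = (fun t' : ↥(HeisRing.fixedPart (conjLocal L (IsCMField.complexConj L) v)) => (t' : LocalRing L v) w) ⁻¹'
        {z : w.1.adicCompletion L | Valued.v z = Valued.v (t w)} := rfl
    rw [h]
    exact (isOpen_setOf_valued_eq_valued L v w ht0).preimage ((continuous_apply w).comp continuous_subtype_val)
  have hSne : Sph.Nonempty := ⟨⟨t, (HeisRing.mem_fixedPart_iff _ _).2 ht⟩, rfl⟩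
  have hSfin : μP Sph ≠ ⊤ := by
    have hBPc : IsCompact {a : ↥(HeisRing.fixedPart (conjLocal L (IsCMField.complexConj L) v)) | Valued.v ((a : LocalRing L v) w) ≤ 1} :=
      (HeisRing.isClosed_fixedPart _ hσc).isClosedEmbedding_subtypeVal.isCompact_preimage (isCompact_setOf_valued_apply_le_one L v w hw)
    refine ((measure_mono fun t' ht' => ?_).trans_lt hBPc.measure_lt_top).ne
    show Valued.v ((t' : LocalRing L v) w) ≤ 1
    rw [show Valued.v ((t' : LocalRing L v) w) = Valued.v (t w) from ht', htj]; exact pow_le_one₀ zero_le hϖ1.le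
  have hSpos : (μP.real Sph : ℂ) ≠ 0 := by
    rw [Ne, Complex.ofReal_eq_zero, measureReal_def, ENNReal.toReal_eq_zero_iff, not_or]
    exact ⟨(hSo.measure_pos μP hSne).ne', hSfin⟩
  exact (mul_eq_zero.1 hzero).resolve_left hSpos

open scoped Classical in
include hw in
/-- **(K-lo-c) ABOVE THE CONDUCTOR LEVEL — `|ϖ|^m < |t|_w ⟹ K_c(t) = 0`** for a `σ`-fixed `t` (three cases: `|t|_w = |ϖ|^j`, `1 ≤ j < m`, and `|t|_w = 1` by the sphere theorem;
`|t|_w > 1` by ★ `shearLineIntegral_eq_zero_of_one_lt_valued` — empty region).  = p04's (K-lo) at the sheared base `a := t·c`; NO `|2|_w = 1`. [cite: Keys1984, §4–§5, §7 Theorem (2) p. 126]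
[cite: Roche1998, §3–§4] -/
theorem shearLineIntegral_eq_zero_of_pow_lt (χ₁ : (LocalRing L v)ˣ →* ℂˣ) (h₁ : Continuous fun x => ((χ₁ x : ℂˣ) : ℂ))
    (hfix : ∀ u : (LocalRing L v)ˣ, (∀ w' : PlacesOver L v, Valued.v ((u : LocalRing L v) w') = 1) →
      conjLocal L (IsCMField.complexConj L) v (u : LocalRing L v) = u → χ₁ u = 1)
    {ϖ : w.1.adicCompletion L} (hϖ : Valued.v ϖ = WithZero.exp (-1 : ℤ)) {m : ℕ} (hm : 1 ≤ m)
    (u₁ : (LocalRing L v)ˣ) (hu₁ : ∀ w' : PlacesOver L v, Valued.v (((u₁ : LocalRing L v) w') - 1) ≤ Valued.v ϖ ^ m) (hχu₁ : χ₁ u₁ ≠ 1)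
    {c : LocalRing L v} (hc : conjLocal L (IsCMField.complexConj L) v c + c = 1) (hcw : Valued.v (c w) ≤ 1)
    {t : LocalRing L v} (ht : conjLocal L (IsCMField.complexConj L) v t = t) (hlt : Valued.v ϖ ^ m < Valued.v (t w)) :
    ∫ y in {y : ↥(HeisRing.skewPart (conjLocal L (IsCMField.complexConj L) v)) | Valued.v ((t * c + (y : LocalRing L v)) w) = 1},
        (fun r : LocalRing L v => if h : IsUnit r then ((χ₁ h.unit : ℂˣ) : ℂ) else 0) (t * c + (y : LocalRing L v)) ∂μY = 0 := by
  rcases le_or_gt (Valued.v (t w)) 1 with hle | hgt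
  · obtain ⟨j, hjm, htj⟩ := exists_eq_pow_of_pow_lt_of_le_one L v w hϖ hlt hle
    exact shearLineIntegral_eq_zero_of_valued_eq_pow_of_lt L v w hw μY χ₁ h₁ hfix hϖ hm u₁ hu₁ hχu₁ hc hcw ht hjm htj
  · exact shearLineIntegral_eq_zero_of_one_lt_valued L v w hw μY χ₁ hc ht hgt

open scoped Classical in
include hw in
/-- **(K-mid-c) AT THE CONDUCTOR LEVEL — `|t|_w = |ϖ|^m ⟹ K_c(t) = −ε₀ · m₀`** (`m₀ = μ⁻{|y|_w < 1}`) for a `σ`-fixed `t`, a trace-one `c`, a character of conductor exactly `m + 1`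
(`hcond` at `ϖ^{m+1}`, witness `u₁` at `ϖ^m`) in inert Branch B, at a non-split UNRAMIFIED place of any residue characteristic.  The trace cut `{|x| ≤ |ϖ|^m}` is stable, so
`0 = ∫_{|t′| ≤ |ϖ|^m} K_c = μ⁺{|t′| = |ϖ|^m}·K_c(t) + μ⁺{|t′| ≤ |ϖ|^{m+1}}·ε₀m₁` (§3, §1 sphere constancy, (K-hi-c)); `μ⁺{|t′| = |ϖ|^m} = (q − 1)·μ⁺{|t′| ≤ |ϖ|^{m+1}}` (§5) and
`m₁ = (q − 1)·m₀` (★ `measure_setOf_skew_valued_lt_one`) give `K_c(t) = −ε₀m₀`.  = p04's (K-mid) at the sheared base `a := t·c`; at `v ∣ 2` the un-sheared statement is FALSE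
(census §2). [cite: Keys1984, §4–§5, §7 Theorem (2) p. 126] [cite: Roche1998, §3–§4] [cite: WeilBNT1967, Ch. II §5] [cite: Serre1979, Ch. V §2] -/
theorem shearLineIntegral_eq_of_valued_eq_pow (hunr : Algebra.IsUnramifiedIn (𝓞 L) v.asIdeal)
    (χ₁ : (LocalRing L v)ˣ →* ℂˣ) (h₁ : Continuous fun x => ((χ₁ x : ℂˣ) : ℂ))
    (hfix : ∀ u : (LocalRing L v)ˣ, (∀ w' : PlacesOver L v, Valued.v ((u : LocalRing L v) w') = 1) →
      conjLocal L (IsCMField.complexConj L) v (u : LocalRing L v) = u → χ₁ u = 1)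
    (δ₀ : (LocalRing L v)ˣ) (hδσ : conjLocal L (IsCMField.complexConj L) v (δ₀ : LocalRing L v) = -(δ₀ : LocalRing L v)) (hδv : Valued.v ((δ₀ : LocalRing L v) w) = 1)
    {ϖ : w.1.adicCompletion L} (hϖ : Valued.v ϖ = WithZero.exp (-1 : ℤ)) {m : ℕ} (hm : 1 ≤ m)
    (hcond : ∀ u : (LocalRing L v)ˣ, (∀ w' : PlacesOver L v, Valued.v (((u : LocalRing L v) w') - 1) ≤ Valued.v ϖ ^ (m + 1)) → χ₁ u = 1)
    (u₁ : (LocalRing L v)ˣ) (hu₁ : ∀ w' : PlacesOver L v, Valued.v (((u₁ : LocalRing L v) w') - 1) ≤ Valued.v ϖ ^ m) (hχu₁ : χ₁ u₁ ≠ 1)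
    {c : LocalRing L v} (hc : conjLocal L (IsCMField.complexConj L) v c + c = 1) (hcw : Valued.v (c w) ≤ 1)
    {t : LocalRing L v} (ht : conjLocal L (IsCMField.complexConj L) v t = t) (heq : Valued.v (t w) = Valued.v ϖ ^ m) :
    ∫ y in {y : ↥(HeisRing.skewPart (conjLocal L (IsCMField.complexConj L) v)) | Valued.v ((t * c + (y : LocalRing L v)) w) = 1},
        (fun r : LocalRing L v => if h : IsUnit r then ((χ₁ h.unit : ℂˣ) : ℂ) else 0) (t * c + (y : LocalRing L v)) ∂μY =
      -(((χ₁ δ₀ : ℂˣ) : ℂ) * (μY.real {y : ↥(HeisRing.skewPart (conjLocal L (IsCMField.complexConj L) v)) | Valued.v ((y : LocalRing L v) w) < 1} : ℂ)) := by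
  haveI : SecondCountableTopology (LocalRing L v) := secondCountableTopology_localRing (E := L) v
  have hσc := continuous_conjLocal L (IsCMField.complexConj L) v
  haveI := HeisRing.locallyCompactSpace_fixedPart (conjLocal L (IsCMField.complexConj L) v) hσc
  haveI := HeisRing.locallyCompactSpace_skewPart (conjLocal L (IsCMField.complexConj L) v) hσc
  haveI : SecondCountableTopology ↥(HeisRing.fixedPart (conjLocal L (IsCMField.complexConj L) v)) := TopologicalSpace.Subtype.secondCountableTopology _
  set μP : Measure ↥(HeisRing.fixedPart (conjLocal L (IsCMField.complexConj L) v)) := Measure.addHaar with hμP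
  haveI : μP.Regular := inferInstance
  have hϖ0 : 0 < Valued.v ϖ := by rw [hϖ]; exact WithZero.exp_pos
  have hϖ1 : Valued.v ϖ < 1 := by rw [hϖ, ← WithZero.exp_zero]; exact WithZero.exp_lt_exp.2 (by norm_num)
  have ht0 : Valued.v (t w) ≠ 0 := by rw [heq]; exact pow_ne_zero m hϖ0.ne'
  -- names: the fibre `K`, the constants
  set K : ↥(HeisRing.fixedPart (conjLocal L (IsCMField.complexConj L) v)) → ℂ := fun t' =>
    ∫ y in {y : ↥(HeisRing.skewPart (conjLocal L (IsCMField.complexConj L) v)) | Valued.v (((t' : LocalRing L v) * c + (y : LocalRing L v)) w) = 1},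
      (fun r : LocalRing L v => if h : IsUnit r then ((χ₁ h.unit : ℂˣ) : ℂ) else 0) ((t' : LocalRing L v) * c + (y : LocalRing L v)) ∂μY with hKdef
  set K₀ : ℂ := ∫ y in {y : ↥(HeisRing.skewPart (conjLocal L (IsCMField.complexConj L) v)) | Valued.v ((t * c + (y : LocalRing L v)) w) = 1},
      (fun r : LocalRing L v => if h : IsUnit r then ((χ₁ h.unit : ℂˣ) : ℂ) else 0) (t * c + (y : LocalRing L v)) ∂μY with hK₀
  set ε₀ : ℂ := ((χ₁ δ₀ : ℂˣ) : ℂ) with hε₀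
  set m₁ : ℝ := μY.real {y : ↥(HeisRing.skewPart (conjLocal L (IsCMField.complexConj L) v)) | Valued.v ((y : LocalRing L v) w) = 1} with hm₁
  set m₀ : ℝ := μY.real {y : ↥(HeisRing.skewPart (conjLocal L (IsCMField.complexConj L) v)) | Valued.v ((y : LocalRing L v) w) < 1} with hm₀
  set Sm : Set ↥(HeisRing.fixedPart (conjLocal L (IsCMField.complexConj L) v)) := {t' | Valued.v ((t' : LocalRing L v) w) = Valued.v (t w)} with hSm
  set Bm : Set ↥(HeisRing.fixedPart (conjLocal L (IsCMField.complexConj L) v)) := {t' | Valued.v ((t' : LocalRing L v) w) ≤ Valued.v ϖ ^ m} with hBm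
  set Bm1 : Set ↥(HeisRing.fixedPart (conjLocal L (IsCMField.complexConj L) v)) := {t' | Valued.v ((t' : LocalRing L v) w) ≤ Valued.v ϖ ^ (m + 1)} with hBm1
  -- the trace cut `P = {|x| ≤ |ϖ|^m}`: Borel and stable under `|ϖ|^m`-perturbations
  set P : Set (LocalRing L v) := {x : LocalRing L v | Valued.v (x w) ≤ Valued.v ϖ ^ m} with hPdef
  have hP : MeasurableSet P := by
    have h : P = (fun x : LocalRing L v => x w) ⁻¹' {z : w.1.adicCompletion L | Valued.v z ≤ Valued.v (ϖ ^ m)} := by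
      ext x; rw [hPdef, Set.mem_setOf_eq, Set.mem_preimage, Set.mem_setOf_eq, map_pow]
    rw [h]
    exact ((isClosed_setOf_valued_le_valued L v w (ϖ ^ m)).preimage (continuous_apply w)).measurableSet
  have hPst : ∀ x x' : LocalRing L v, x ∈ P → Valued.v (x w) ≤ 1 → Valued.v ((x' - x) w) ≤ Valued.v ϖ ^ m → x' ∈ P := by
    intro x x' hx _ hxx'
    show Valued.v (x' w) ≤ Valued.v ϖ ^ m
    rw [show x' w = x w + (x' - x) w by rw [Pi.sub_apply]; ring]
    exact (Valuation.map_add _ _ _).trans (max_le hx hxx')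
  -- §3: `∫ 𝟙_{B_m} K dμ⁺ = 0`
  have hzero := integral_indicator_shearLineIntegral_eq_zero_of_traceCut L v w hw μY χ₁ h₁ hϖ hm u₁ hu₁ hχu₁ hc hcw μP hP hPst
  -- split `B_m = S_m ⊔ B_{m+1}` on the integrand, using §1 (constancy) and (K-hi-c)
  have hsplit : ∀ t' : ↥(HeisRing.fixedPart (conjLocal L (IsCMField.complexConj L) v)),
      ({t'' : ↥(HeisRing.fixedPart (conjLocal L (IsCMField.complexConj L) v)) | (t'' : LocalRing L v) ∈ P} : Set _).indicator K t' =
        Sm.indicator (fun _ => K₀) t' + Bm1.indicator (fun _ => ε₀ * (m₁ : ℂ)) t' := by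
    intro t'
    by_cases hS : t' ∈ Sm
    · have hS' : Valued.v ((t' : LocalRing L v) w) = Valued.v (t w) := hS
      have hPt : t' ∈ ({t'' : ↥(HeisRing.fixedPart (conjLocal L (IsCMField.complexConj L) v)) | (t'' : LocalRing L v) ∈ P} : Set _) := by
        show Valued.v ((t' : LocalRing L v) w) ≤ Valued.v ϖ ^ m; rw [hS', heq]
      have hB : t' ∉ Bm1 := fun hB => by
        have hB' : Valued.v ((t' : LocalRing L v) w) ≤ Valued.v ϖ ^ (m + 1) := hB
        rw [hS', heq] at hB'
        exact not_le.2 (pow_lt_pow_right_of_lt_one₀ hϖ0 hϖ1 (Nat.lt_succ_self m)) hB'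
      rw [Set.indicator_of_mem hPt, Set.indicator_of_mem hS, Set.indicator_of_notMem hB, add_zero]
      exact shearLineIntegral_eq_of_valued_eq L v w hw μY χ₁ hfix c ht ((HeisRing.mem_fixedPart_iff _ _).1 t'.2) ht0 hS'
    · by_cases hB : t' ∈ Bm1
      · have hB' : Valued.v ((t' : LocalRing L v) w) ≤ Valued.v ϖ ^ (m + 1) := hB
        have hPt : t' ∈ ({t'' : ↥(HeisRing.fixedPart (conjLocal L (IsCMField.complexConj L) v)) | (t'' : LocalRing L v) ∈ P} : Set _) := by
          show Valued.v ((t' : LocalRing L v) w) ≤ Valued.v ϖ ^ m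
          exact hB'.trans (pow_le_pow_right_of_le_one' hϖ1.le (Nat.le_succ m))
        rw [Set.indicator_of_mem hPt, Set.indicator_of_notMem hS, Set.indicator_of_mem hB, zero_add]
        exact shearLineIntegral_eq_of_valued_le_pow_succ L v w hw μY χ₁ hfix δ₀ hδσ hδv hϖ hcond hcw hB'
      · have hPt : t' ∉ ({t'' : ↥(HeisRing.fixedPart (conjLocal L (IsCMField.complexConj L) v)) | (t'' : LocalRing L v) ∈ P} : Set _) := fun hPt => by
          have hPt' : Valued.v ((t' : LocalRing L v) w) ≤ Valued.v ϖ ^ m := hPt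
          rcases ((valued_eq_pow_iff L v w hϖ m _).2 ⟨hPt', hB⟩) with hEq
          exact hS (show Valued.v ((t' : LocalRing L v) w) = Valued.v (t w) by rw [hEq, heq])
        rw [Set.indicator_of_notMem hPt, Set.indicator_of_notMem hS, Set.indicator_of_notMem hB, add_zero]
  -- the two pieces are Borel of finite mass; integrate
  have hBPc : IsCompact {a : ↥(HeisRing.fixedPart (conjLocal L (IsCMField.complexConj L) v)) | Valued.v ((a : LocalRing L v) w) ≤ 1} :=
    (HeisRing.isClosed_fixedPart _ hσc).isClosedEmbedding_subtypeVal.isCompact_preimage (isCompact_setOf_valued_apply_le_one L v w hw)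
  have hSo : IsOpen Sm := by
    have h : Sm = (fun t' : ↥(HeisRing.fixedPart (conjLocal L (IsCMField.complexConj L) v)) => (t' : LocalRing L v) w) ⁻¹'
        {z : w.1.adicCompletion L | Valued.v z = Valued.v (t w)} := rfl
    rw [h]
    exact (isOpen_setOf_valued_eq_valued L v w ht0).preimage ((continuous_apply w).comp continuous_subtype_val)
  have hSmeas : MeasurableSet Sm := hSo.measurableSet
  have hBm1meas : MeasurableSet Bm1 := by
    have h : Bm1 = (fun t' : ↥(HeisRing.fixedPart (conjLocal L (IsCMField.complexConj L) v)) => (t' : LocalRing L v) w) ⁻¹'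
        {z : w.1.adicCompletion L | Valued.v z ≤ Valued.v (ϖ ^ (m + 1))} := by
      ext t'; rw [hBm1, Set.mem_setOf_eq, Set.mem_preimage, Set.mem_setOf_eq, map_pow]
    rw [h]
    exact ((isClosed_setOf_valued_le_valued L v w (ϖ ^ (m + 1))).preimage ((continuous_apply w).comp continuous_subtype_val)).measurableSet
  have hBmmeas : MeasurableSet Bm := by
    have h : Bm = (fun t' : ↥(HeisRing.fixedPart (conjLocal L (IsCMField.complexConj L) v)) => (t' : LocalRing L v) w) ⁻¹'
        {z : w.1.adicCompletion L | Valued.v z ≤ Valued.v (ϖ ^ m)} := by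
      ext t'; rw [hBm, Set.mem_setOf_eq, Set.mem_preimage, Set.mem_setOf_eq, map_pow]
    rw [h]
    exact ((isClosed_setOf_valued_le_valued L v w (ϖ ^ m)).preimage ((continuous_apply w).comp continuous_subtype_val)).measurableSet
  have hSsub : Sm ⊆ {a | Valued.v ((a : LocalRing L v) w) ≤ 1} := fun t' ht' => by
    show Valued.v ((t' : LocalRing L v) w) ≤ 1
    rw [show Valued.v ((t' : LocalRing L v) w) = Valued.v (t w) from ht', heq]; exact pow_le_one₀ zero_le hϖ1.le
  have hBsub : Bm ⊆ {a | Valued.v ((a : LocalRing L v) w) ≤ 1} := fun t' ht' =>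
    (show Valued.v ((t' : LocalRing L v) w) ≤ Valued.v ϖ ^ m from ht').trans (pow_le_one₀ zero_le hϖ1.le)
  have hB1subB : Bm1 ⊆ Bm := fun t' ht' =>
    (show Valued.v ((t' : LocalRing L v) w) ≤ Valued.v ϖ ^ (m + 1) from ht').trans (pow_le_pow_right_of_le_one' hϖ1.le (Nat.le_succ m))
  have hSfin : μP Sm ≠ ⊤ := ((measure_mono hSsub).trans_lt hBPc.measure_lt_top).ne
  have hBfin : μP Bm ≠ ⊤ := ((measure_mono hBsub).trans_lt hBPc.measure_lt_top).ne
  have hB1fin : μP Bm1 ≠ ⊤ := ((measure_mono (hB1subB.trans hBsub)).trans_lt hBPc.measure_lt_top).ne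
  have hI1 : Integrable (Sm.indicator (fun _ => K₀)) μP := (integrableOn_const (hs := hSfin)).integrable_indicator hSmeas
  have hI2 : Integrable (Bm1.indicator (fun _ => ε₀ * (m₁ : ℂ))) μP := (integrableOn_const (hs := hB1fin)).integrable_indicator hBm1meas
  rw [integral_congr_ae (Filter.Eventually.of_forall hsplit), integral_add hI1 hI2, integral_indicator_const _ hSmeas, integral_indicator_const _ hBm1meas,
    Complex.real_smul, Complex.real_smul] at hzero
  -- the sphere is the ball minus the deeper ball; the two ratios
  have hSeq : Sm = Bm \ Bm1 := by
    ext t'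
    rw [Set.mem_sdiff, hSm, hBm, hBm1, Set.mem_setOf_eq, Set.mem_setOf_eq, Set.mem_setOf_eq, heq]
    exact valued_eq_pow_iff L v w hϖ m _
  have hq1 : (1 : ℝ) < (Ideal.absNorm v.asIdeal : ℝ) := by exact_mod_cast NumberField.HeightOneSpectrum.one_lt_absNorm v
  have hq0 : (Ideal.absNorm v.asIdeal : ℝ) ≠ 0 := (lt_trans zero_lt_one hq1).ne'
  have hratP : μP.real Bm1 = ((Ideal.absNorm v.asIdeal : ℝ))⁻¹ * μP.real Bm := measureReal_fixedBall_pow_succ L v w hw hunr μP hϖ m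
  have hSval : μP.real Sm = ((Ideal.absNorm v.asIdeal : ℝ) - 1) * μP.real Bm1 := by
    rw [hSeq, measureReal_sdiff hB1subB hBm1meas hBfin, hratP]
    field_simp
  have hratY : m₀ = ((Ideal.absNorm v.asIdeal : ℝ))⁻¹ *
      μY.real {y : ↥(HeisRing.skewPart (conjLocal L (IsCMField.complexConj L) v)) | Valued.v ((y : LocalRing L v) w) ≤ 1} := by
    rw [hm₀, measureReal_def, measure_setOf_skew_valued_lt_one L v w hw μY hunr, ENNReal.smul_def, smul_eq_mul, ENNReal.toReal_mul, ENNReal.coe_toReal,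
      NNReal.coe_inv, NNReal.coe_natCast, measureReal_def]
  have hBYc : IsCompact {y : ↥(HeisRing.skewPart (conjLocal L (IsCMField.complexConj L) v)) | Valued.v ((y : LocalRing L v) w) ≤ 1} :=
    (HeisRing.isClosed_skewPart _ hσc).isClosedEmbedding_subtypeVal.isCompact_preimage (isCompact_setOf_valued_apply_le_one L v w hw)
  have hm1val : m₁ = ((Ideal.absNorm v.asIdeal : ℝ) - 1) * m₀ := by
    have hset : {y : ↥(HeisRing.skewPart (conjLocal L (IsCMField.complexConj L) v)) | Valued.v ((y : LocalRing L v) w) = 1} =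
        {y : ↥(HeisRing.skewPart (conjLocal L (IsCMField.complexConj L) v)) | Valued.v ((y : LocalRing L v) w) ≤ 1} \
          {y : ↥(HeisRing.skewPart (conjLocal L (IsCMField.complexConj L) v)) | Valued.v ((y : LocalRing L v) w) < 1} := by
      ext y; simp only [Set.mem_setOf_eq, Set.mem_sdiff, not_lt]; exact ⟨fun h => ⟨h.le, h.ge⟩, fun h => le_antisymm h.1 h.2⟩
    have hsub : {y : ↥(HeisRing.skewPart (conjLocal L (IsCMField.complexConj L) v)) | Valued.v ((y : LocalRing L v) w) < 1} ⊆
        {y : ↥(HeisRing.skewPart (conjLocal L (IsCMField.complexConj L) v)) | Valued.v ((y : LocalRing L v) w) ≤ 1} := fun y hy =>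
      show Valued.v ((y : LocalRing L v) w) ≤ 1 from le_of_lt hy
    have hsd := measureReal_sdiff (μ := μY) hsub (measurableSet_skew_balls L v w).2.1 hBYc.measure_lt_top.ne
    rw [hm₁, hset, hsd, ← hm₀, hratY]
    field_simp
  -- `0 < μ⁺(B_{m+1})`
  have hB1pos : μP.real Bm1 ≠ 0 := by
    have hBo : IsOpen Bm1 := by
      have h : Bm1 = (fun t' : ↥(HeisRing.fixedPart (conjLocal L (IsCMField.complexConj L) v)) => (t' : LocalRing L v) w) ⁻¹'
          {z : w.1.adicCompletion L | Valued.v z ≤ Valued.v (ϖ ^ (m + 1))} := by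
        ext t'; rw [hBm1, Set.mem_setOf_eq, Set.mem_preimage, Set.mem_setOf_eq, map_pow]
      rw [h]
      exact (isOpen_setOf_valued_le_valued L v w (by rw [map_pow]; exact pow_ne_zero _ hϖ0.ne')).preimage ((continuous_apply w).comp continuous_subtype_val)
    have hBne : Bm1.Nonempty := ⟨⟨0, (HeisRing.fixedPart (conjLocal L (IsCMField.complexConj L) v)).zero_mem⟩, by
      show Valued.v ((0 : LocalRing L v) w) ≤ Valued.v ϖ ^ (m + 1)
      rw [Pi.zero_apply, map_zero]; exact zero_le⟩
    rw [measureReal_def, Ne, ENNReal.toReal_eq_zero_iff, not_or]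
    exact ⟨(hBo.measure_pos μP hBne).ne', hB1fin⟩
  -- conclude: `(q−1)·b·K₀ = −b·ε₀·(q−1)·m₀`
  rw [hSval, hm1val] at hzero
  have hb : ((μP.real Bm1 : ℝ) : ℂ) ≠ 0 := Complex.ofReal_ne_zero.2 hB1pos
  have hq1' : (((Ideal.absNorm v.asIdeal : ℝ) - 1 : ℝ) : ℂ) ≠ 0 := Complex.ofReal_ne_zero.2 (sub_ne_zero.2 hq1.ne')
  have h2 : ((((Ideal.absNorm v.asIdeal : ℝ) - 1) * μP.real Bm1 : ℝ) : ℂ) * (K₀ + ε₀ * (m₀ : ℂ)) = 0 := by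
    rw [Complex.ofReal_mul] at hzero ⊢
    have h := hzero
    push_cast at h ⊢
    linear_combination h
  have hne : ((((Ideal.absNorm v.asIdeal : ℝ) - 1) * μP.real Bm1 : ℝ) : ℂ) ≠ 0 := by
    rw [Complex.ofReal_mul]; exact mul_ne_zero hq1' hb
  have h3 := (mul_eq_zero.1 h2).resolve_left hne
  linear_combination h3
end Fibres

end Summit.HodgeConjecture.HodgeConjecture.R90.S1.BposDyadicSkewLineFibreValues

end
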